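import Mathlib
import Literature.Geometry.Lorentzian.TameGenericityDiagonal
import Literature.Geometry.Lorentzian.TameGenericityLocal
import Literature.Geometry.Lorentzian.TameFamilyOffCompact
import Literature.Geometry.Lorentzian.AdmissibleMGHDExistence

/-!
# Route PhotonSphereChannels · crux `TameCensorship` (stmt-FinalStateConjecture-17431) · line `Sketch`, skeleton v6 ·
# the KILL SHAPE of the robust stubs (interface for the disprover)

Helper file (`--supports stmt-FinalStateConjecture-17431`, registered as `stub_notRobust_of_stableViolation`) of line `Sketch`
(lead c2, 2026-08-17). The two OPEN stubs of the line (`stub_extremalChartFreeRobust`, `stub_tameOuterRobust`) assert ROBUST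
ESCAPABILITY of a property `Q` of initial data at every admissible datum `d`: every compactly supported smooth admissible probe
through `d` enriches to one along all of whose further enrichments an open dense set of radial directions is `Q`-good for all small
non-zero parameters. This file lands, def-free and for an ABSTRACT property `Q`, the refutation shape recorded in the skeleton
(`not_robust_of_forall_not`): robust escapability of `Q` at an admissible `d` FAILS as soon as `Q` fails on every admissible datum
agreeing with `d` off a compact set — a STABLE violation along compactly supported admissible deformations of ONE admissible datum
kills the stub at `d` (the constant `0`-parameter family through `d` is a probe; its enrichment's dense good set is non-empty). It is
the importable target shape for the crux's disprover (`disprover-wanted: stub_tameOuterRobust`), complementing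
`CruxAttack17431.not_tameCensorship_of_stable` for the crux itself.

References: D. Christodoulou, *On the global initial value problem and the issue of singularities*, CQG 16 (1999) A23, §4
(codimension / genericity formulations); the route file `Theses/RobustClausewiseGenericity.lean` (the probe legend).
-/

set_option linter.dupNamespace false

open Literature.Geometry.Lorentzian
open scoped Manifold ContDiff Topology
open Set Function

noncomputable section

namespace Summit.FinalStateConjecture.FinalStateConjecture.Theorems.PhotonSphereChannels.TameCensorshipUnwind

/-- **Kill shape of robust escapability** (def-free): if `Q` fails on every admissible datum that agrees with the admissible
`d` (both fundamental forms) off some compact set, then `Q` is NOT robustly escapable at `d` — the robust quantifier block of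
`CensorshipRobust` / `stub_extremalChartFreeRobust` / `stub_tameOuterRobust` (probes = jointly smooth admissible families through
`d` agreeing with `d` off one compact set) is false for this `Q`. Proof: the constant family `fun _ ↦ d` on `ℝ⁰` is a probe; its
enrichment `G₁` is a probe whose own trivial further enrichment has an open DENSE, hence non-empty, set of good directions `v`
with `Q (G₁ (t • v))` for small `t ≠ 0`; but `G₁ (t • v)` is admissible and agrees with `d` off a compact set. [folklore] -/
theorem stub_notRobust_of_stableViolation :
    ∀ (X : Type) [TopologicalSpace X] [ChartedSpace E3 X] [IsManifold (𝓡 3) ∞ X] [T2Space X]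
    [SecondCountableTopology X] [ConnectedSpace X] (d : InitialDataSet (𝓡 3) X) (Q : InitialDataSet (𝓡 3) X → Prop),
    d ∈ admissibleVacuumData X →
    (∀ D ∈ admissibleVacuumData X,
      (∃ K : Set X, IsCompact K ∧ ∀ x ∉ K, D.h.inner x = d.h.inner x ∧ D.k x = d.k x) → ¬ Q D) →
    ¬ (∀ (m : ℕ) (G : EuclideanSpace ℝ (Fin m) → InitialDataSet (𝓡 3) X),
        (InitialDataSet.IsSmoothDataFamily m G ∧ G 0 = d ∧ (∀ c, G c ∈ admissibleVacuumData X) ∧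
          ∃ K : Set X, IsCompact K ∧ ∀ c, ∀ x ∉ K, (G c).h.inner x = d.h.inner x ∧ (G c).k x = d.k x) →
        ∃ (n : ℕ) (G₁ : EuclideanSpace ℝ (Fin n) → InitialDataSet (𝓡 3) X)
          (L : EuclideanSpace ℝ (Fin m) →ₗ[ℝ] EuclideanSpace ℝ (Fin n)),
          Function.Injective L ∧
            (InitialDataSet.IsSmoothDataFamily n G₁ ∧ G₁ 0 = d ∧ (∀ c, G₁ c ∈ admissibleVacuumData X) ∧
              ∃ K : Set X, IsCompact K ∧ ∀ c, ∀ x ∉ K, (G₁ c).h.inner x = d.h.inner x ∧ (G₁ c).k x = d.k x) ∧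
            (∀ c, G₁ (L c) = G c) ∧
              ∀ (p : ℕ) (G₂ : EuclideanSpace ℝ (Fin p) → InitialDataSet (𝓡 3) X)
                (L' : EuclideanSpace ℝ (Fin n) →ₗ[ℝ] EuclideanSpace ℝ (Fin p)),
                Function.Injective L' →
                  (InitialDataSet.IsSmoothDataFamily p G₂ ∧ G₂ 0 = d ∧ (∀ c, G₂ c ∈ admissibleVacuumData X) ∧
                    ∃ K : Set X, IsCompact K ∧ ∀ c, ∀ x ∉ K,
                      (G₂ c).h.inner x = d.h.inner x ∧ (G₂ c).k x = d.k x) →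
                  (∀ c, G₂ (L' c) = G₁ c) →
                    ∃ U : Set (EuclideanSpace ℝ (Fin p)), IsOpen U ∧ Dense U ∧
                      ∀ v ∈ U, ∃ δ : ℝ, 0 < δ ∧ ∀ t : ℝ, t ≠ 0 → |t| < δ → Q (G₂ (t • v))) := by
  intro X _ _ _ _ _ _ d Q hd hQ h
  -- the constant `0`-parameter family through `d` is a probe
  have hprobe : InitialDataSet.IsSmoothDataFamily 0 (fun _ : EuclideanSpace ℝ (Fin 0) ↦ d) ∧
      (fun _ : EuclideanSpace ℝ (Fin 0) ↦ d) 0 = d ∧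
      (∀ _c : EuclideanSpace ℝ (Fin 0), d ∈ admissibleVacuumData X) ∧
      ∃ K : Set X, IsCompact K ∧ ∀ _c : EuclideanSpace ℝ (Fin 0), ∀ x ∉ K,
        d.h.inner x = d.h.inner x ∧ d.k x = d.k x :=
    ⟨InitialDataSet.isSmoothDataFamily_const 0 d, rfl, fun _ ↦ hd, ∅, isCompact_empty, fun _ _ _ ↦ ⟨rfl, rfl⟩⟩
  obtain ⟨n, G₁, L, -, hT₁, -, hR⟩ := h 0 (fun _ ↦ d) hprobe
  obtain ⟨U, -, hUd, hU⟩ := hR n G₁ LinearMap.id (fun _ _ hab ↦ hab) hT₁ (fun _ ↦ rfl)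
  obtain ⟨v, hv⟩ := hUd.nonempty
  obtain ⟨δ, hδ, hgood⟩ := hU v hv
  obtain ⟨-, -, hadm, K, hK, hGK⟩ := hT₁
  have hδ2 : |δ / 2| < δ := by
    rw [abs_of_pos (half_pos hδ)]
    exact half_lt_self hδ
  exact hQ _ (hadm _) ⟨K, hK, hGK _⟩ (hgood (δ / 2) (half_pos hδ).ne' hδ2)

end Summit.FinalStateConjecture.FinalStateConjecture.Theorems.PhotonSphereChannels.TameCensorshipUnwind

end
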